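import Summits.MatrixMultiplication.OmegaCensus.BoxUsefulCoordQuot
import Summits.MatrixMultiplication.OmegaCensus.BoxUsefulSylowDichotomy
import Summits.MatrixMultiplication.OmegaCensus.BoxUsefulThreeElements
import Summits.MatrixMultiplication.OmegaCensus.BoxUsefulNilpotentLaw
import Summits.MatrixMultiplication.OmegaCensus.DihC3SqGroups

/-!
# ω-census, family (b3): conjecture C9 (b) — the CENTRE-LIFTING THEOREM for the class `𝒞₂`: if `G/Z(G) ∈ 𝒞₂` then `G` is lawful

HONEST FRAMING (pub-omega census; verbatim): lottery ticket; floor = certified bounds/negative ranges.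
Census BOOKKEEPING (conjecture C9 of the cell, STRUCTURE.md §2; pub-omega kernel-l4 gen 16, task K-5, structure part).

**Theorem (`CentreLift.lawful_of_coord2_quotient`).** Let `G` be finite and box-useful and suppose the central quotient
`Ḡ = G/Z(G)` carries the `𝒞₂` package `DihC3Sq.Coord2 c̄₁ c̄₂ κ₁ κ₂ ε` (`Ḡ = K̄ ⋊_ε C̄`).  Then `G` is lawful: `[G:Z(G)] ∈ {1, 4, 6}`
or `G` itself carries a `Coord2` package.  With `BoxUsefulCentreLift` (centre index `6`) and g15's nilpotent theorem (centre
index `1, 4`) this completes: **the conclusion of C9 (b) lifts through box-useful central extensions**, i.e. C9 (b) for a box-useful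
`G` follows from C9 (b) for `G/Z(G)`; by induction C9 (b) reduces to CENTRELESS box-useful groups.
*Proof.* If `ε ≡ 1` then `Ḡ` is abelian and `G` is nilpotent (g15).  Otherwise pick a `2`-element `s` with `ε(s̄) = -1`,
`κ(s̄) = 0`, and commuting `3`-elements `r₁, r₂` over `K̄` with `κ(r̄₁) = (e₁, 0)`, `κ(r̄₂) = (0, e₂)` (lifts, `3`-parts, one
Sylow-`3` conjugation).  `aᵢ := ⁅rᵢ, s⁆ = rᵢ² wᵢ⁻¹` (`wᵢ` central) are commuting, inverted by `s`, with images generating `K̄`;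
`aᵢ³ = 1` by `ThreeElt.pow_three_eq_one_of_inverted` (`D₁₈`).  A Sylow `2`-subgroup `P ∋ s` lies in `Z₂ ∪ Z₂ s` (elements of
`2`-power order with `ε = 1` are central in `Ḡ`), so `P` is abelian by `CentreLift.sylow_comm_of_dichotomy` (`D₂₄/D₁₈` endgame);
then `C := P ⊔ Z(G)` is abelian, meets `U = ⟨a₁, a₂⟩` trivially, acts on it through `±1`, and `G = U · C` (every element with
`κ = 0` lies in `Z₂ ∪ Z₂ s ⊆ C`) — `DihC3Sq.exists_coord2_of_split`.  Nothing here is progress on `ω`.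
-/

namespace Summit.MatrixMultiplication.OmegaCensus

open Finset ProductBoxBound
open scoped commutatorElement

namespace CentreLift

variable {G : Type*} [Group G] [Fintype G] [DecidableEq G]

/-- `x = k s` with `k` second-central inverts every odd-order element that `s` inverts (box-useful `G`). [folklore] -/
theorem conj_eq_inv_of_secondCentral_mul (hG : BoxUseful G) {a s x : G} (hodd : Odd (orderOf a)) (hsa : s * a * s⁻¹ = a⁻¹)
    (hk : ∀ g : G, ⁅x * s⁻¹, g⁆ ∈ Subgroup.center G) : x * a * x⁻¹ = a⁻¹ := by
  have hka : (x * s⁻¹) * a = a * (x * s⁻¹) := SecondCentre.comm_of_odd hG hk hodd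
  have hka' : (x * s⁻¹) * a⁻¹ = a⁻¹ * (x * s⁻¹) := ((show Commute (x * s⁻¹) a from hka).inv_right).eq
  calc x * a * x⁻¹ = (x * s⁻¹) * (s * a * s⁻¹) * (x * s⁻¹)⁻¹ := by group
    _ = (x * s⁻¹) * a⁻¹ * (x * s⁻¹)⁻¹ := by rw [hsa]
    _ = a⁻¹ := by rw [hka']; group

/-- A second-central element of a box-useful group lies in `P ⊔ Z(G)` for every Sylow `2`-subgroup `P`. [folklore] -/
theorem mem_sylow_sup_center (hG : BoxUseful G) (P : Sylow 2 G) {u : G} (hu : ∀ g : G, ⁅u, g⁆ ∈ Subgroup.center G) :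
    u ∈ (P : Subgroup G) ⊔ Subgroup.center G := by
  classical
  haveI : Fact (Nat.Prime 2) := ⟨Nat.prime_two⟩
  obtain ⟨k, m, hm, hn⟩ := Nat.exists_eq_two_pow_mul_odd (orderOf_pos u).ne'
  have h2k : (2 : ℕ) ^ k ≠ 0 := pow_ne_zero _ two_ne_zero
  have huodd : Odd (orderOf (u ^ 2 ^ k)) := by
    rw [orderOf_pow' u h2k, hn, Nat.gcd_eq_right (Dvd.intro m rfl), Nat.mul_div_cancel_left m (Nat.pos_of_ne_zero h2k)]
    exact hm
  have hoddZ : u ^ 2 ^ k ∈ Subgroup.center G :=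
    SecondCentre.mem_center_of_odd hG (SecondCentre.pow_secondCentral hu _) huodd
  -- the `2`-part lies in a conjugate of `P`; conjugating back costs a central factor
  have hu₂ord : orderOf (u ^ m) = 2 ^ k := orderOf_pow_oddPart hn
  have hPu : IsPGroup 2 (Subgroup.zpowers (u ^ m)) := IsPGroup.of_card (by rw [Nat.card_zpowers, hu₂ord])
  obtain ⟨P₀, hP₀⟩ := hPu.exists_le_sylow
  obtain ⟨x, hx⟩ := MulAction.exists_smul_eq G P₀ P
  have hxu : x * u ^ m * x⁻¹ ∈ (P : Subgroup G) := by
    have e : ((x • P₀ : Sylow 2 G) : Subgroup G) = (P : Subgroup G) := congrArg (fun R : Sylow 2 G => (R : Subgroup G)) hx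
    rw [Sylow.coe_subgroup_smul] at e
    rw [← e]
    have := Subgroup.smul_mem_pointwise_smul (u ^ m) (MulAut.conj x) (P₀ : Subgroup G) (hP₀ (Subgroup.mem_zpowers _))
    simpa [MulAut.smul_def, MulAut.conj_apply] using this
  obtain ⟨w, hw, hwu⟩ := SecondCentre.conj_eq_central_mul (SecondCentre.pow_secondCentral hu m) x
  have htwoZ : u ^ m ∈ (P : Subgroup G) ⊔ Subgroup.center G := by
    have e : u ^ m = w⁻¹ * (x * u ^ m * x⁻¹) := by rw [hwu]; group
    rw [e]
    exact Subgroup.mul_mem _ (Subgroup.mem_sup_right (Subgroup.inv_mem _ hw)) (Subgroup.mem_sup_left hxu)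
  have hcop : Nat.Coprime (2 ^ k) m :=
    Nat.Coprime.pow_left k ((Nat.Prime.coprime_iff_not_dvd Nat.prime_two).mpr hm.not_two_dvd_nat)
  exact mem_of_coprime_pow_mem _ hcop (Subgroup.mem_sup_right hoddZ) htwoZ

omit [Fintype G] [DecidableEq G] in
/-- Membership in `P ⊔ Z(G)`: products `p z`. [folklore] -/
theorem mem_sup_center_iff (P : Subgroup G) (x : G) :
    x ∈ P ⊔ Subgroup.center G ↔ ∃ p ∈ P, ∃ z ∈ Subgroup.center G, p * z = x := by
  rw [← SetLike.mem_coe, Subgroup.mul_normal P (Subgroup.center G), Set.mem_mul]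
  simp only [SetLike.mem_coe]

/-- For a `3`-element `r` over `K̄` and `s` over an `ε = -1` element: `⁅r, s⁆ = r² w⁻¹` with `w` central is a commuting-
friendly element of order `3` (or `1`), inverted by `s`, over `r̄²` (box-useful `G`). [folklore] -/
theorem mk_inverted (hG : BoxUseful G) {d₁ d₂ : G ⧸ Subgroup.center G} {κ₁ κ₂ ε : (G ⧸ Subgroup.center G) → ZMod 3}
    (h : DihC3Sq.Coord2 d₁ d₂ κ₁ κ₂ ε) {s r : G} {b : ℕ} (hεs : ε (QuotientGroup.mk' (Subgroup.center G) s) = -1)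
    (hrb : r ^ 3 ^ b = 1) (hrK : DihC3Sq.InK2 d₁ d₂ (QuotientGroup.mk' (Subgroup.center G) r)) :
    ∃ w ∈ Subgroup.center G, (r * r * w⁻¹) ^ 3 = 1 ∧ s * (r * r * w⁻¹) * s⁻¹ = (r * r * w⁻¹)⁻¹ ∧
      QuotientGroup.mk' (Subgroup.center G) (r * r * w⁻¹) =
        QuotientGroup.mk' (Subgroup.center G) r * QuotientGroup.mk' (Subgroup.center G) r := by
  set π := QuotientGroup.mk' (Subgroup.center G) with hπ
  have hconj : π (s * r * s⁻¹) = (π r)⁻¹ := by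
    rw [map_mul, map_mul, map_inv]; exact CoordLift.conj_inK_of_eps_neg h hrK hεs
  have hwZ : r * (s * r * s⁻¹) ∈ Subgroup.center G := by
    rw [← QuotientGroup.eq_one_iff, ← QuotientGroup.mk'_apply, ← hπ, map_mul, hconj, mul_inv_cancel]
  set w := r * (s * r * s⁻¹) with hwdef
  have hwc := Subgroup.mem_center_iff.mp hwZ
  have hwc' : ∀ g : G, g * w⁻¹ = w⁻¹ * g := fun g => ((show Commute g w from hwc g).inv_right).eq
  have e1 : s * r * s⁻¹ = r⁻¹ * w := by rw [hwdef]; group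
  have hπw : π w = 1 := by rw [hπ, QuotientGroup.mk'_apply, QuotientGroup.eq_one_iff]; exact hwZ
  clear_value w
  have hinvstep : r⁻¹ * (r⁻¹ * w) = (r * r * w⁻¹)⁻¹ := by
    symm; rw [inv_eq_iff_mul_eq_one]
    calc r * r * w⁻¹ * (r⁻¹ * (r⁻¹ * w)) = r * r * (w⁻¹ * r⁻¹) * r⁻¹ * w := by group
      _ = r * r * (r⁻¹ * w⁻¹) * r⁻¹ * w := by rw [← hwc' r⁻¹]
      _ = r * (w⁻¹ * r⁻¹) * w := by group
      _ = r * (r⁻¹ * w⁻¹) * w := by rw [← hwc' r⁻¹]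
      _ = 1 := by group
  refine ⟨w, hwZ, ?_, ?_, ?_⟩
  · -- a `3`-element inverted by `s` has cube `1`
    have hc1 : Commute r (s * r * s⁻¹) := by
      rw [e1]; change r * (r⁻¹ * w) = r⁻¹ * w * r
      rw [mul_assoc, ← hwc r]; group
    have hsr3 : (s * r * s⁻¹) ^ 3 ^ b = 1 := by rw [conj_pow', hrb]; group
    have hw3 : w ^ 3 ^ b = 1 := by
      have ew : w = r * (s * r * s⁻¹) := by rw [e1]; group
      rw [ew, hc1.mul_pow, hrb, hsr3, one_mul]
    have hcrw : Commute (r * r) w⁻¹ := (show Commute (r * r) w from hwc (r * r)).inv_right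
    have ha3b : (r * r * w⁻¹) ^ 3 ^ b = 1 := by
      rw [hcrw.mul_pow, (Commute.refl r).mul_pow, inv_pow, hrb, hw3, inv_one, mul_one, mul_one]
    have hsa : s * (r * r * w⁻¹) * s⁻¹ = (r * r * w⁻¹)⁻¹ := by
      calc s * (r * r * w⁻¹) * s⁻¹ = (s * r * s⁻¹) * (s * r * s⁻¹) * (s * w⁻¹ * s⁻¹) := by group
        _ = (r⁻¹ * w) * (r⁻¹ * w) * (s * w⁻¹ * s⁻¹) := by rw [e1]
        _ = (r⁻¹ * w) * (r⁻¹ * w) * w⁻¹ := by rw [hwc' s]; group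
        _ = r⁻¹ * (w * r⁻¹) := by group
        _ = r⁻¹ * (r⁻¹ * w) := by rw [hwc r⁻¹]
        _ = (r * r * w⁻¹)⁻¹ := hinvstep
    exact ThreeElt.pow_three_eq_one_of_inverted hG ha3b hsa
  · calc s * (r * r * w⁻¹) * s⁻¹ = (s * r * s⁻¹) * (s * r * s⁻¹) * (s * w⁻¹ * s⁻¹) := by group
      _ = (r⁻¹ * w) * (r⁻¹ * w) * (s * w⁻¹ * s⁻¹) := by rw [e1]
      _ = (r⁻¹ * w) * (r⁻¹ * w) * w⁻¹ := by rw [hwc' s]; group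
      _ = r⁻¹ * (w * r⁻¹) := by group
      _ = r⁻¹ * (r⁻¹ * w) := by rw [hwc r⁻¹]
      _ = (r * r * w⁻¹)⁻¹ := hinvstep
  · rw [map_mul, map_mul, map_inv, hπw, inv_one, mul_one]

/-- **Centre lifting for the class `𝒞₂`.** [folklore] -/
theorem lawful_of_coord2_quotient (hG : BoxUseful G) {d₁ d₂ : G ⧸ Subgroup.center G}
    {κ₁ κ₂ ε : (G ⧸ Subgroup.center G) → ZMod 3} (h : DihC3Sq.Coord2 d₁ d₂ κ₁ κ₂ ε) :
    (Subgroup.center G).index = 1 ∨ (Subgroup.center G).index = 4 ∨ (Subgroup.center G).index = 6 ∨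
      ∃ (c₁ c₂ : G) (κ₁' κ₂' ε' : G → ZMod 3), DihC3Sq.Coord2 c₁ c₂ κ₁' κ₂' ε' := by
  classical
  haveI : Fact (Nat.Prime 2) := ⟨Nat.prime_two⟩
  haveI : Fact (Nat.Prime 3) := ⟨Nat.prime_three⟩
  set π : G →* G ⧸ Subgroup.center G := QuotientGroup.mk' (Subgroup.center G) with hπ
  have hπs : Function.Surjective π := QuotientGroup.mk'_surjective _
  -- second-central ↔ central image
  have sc_of_central : ∀ u : G, (∀ q : G ⧸ Subgroup.center G, q * π u = π u * q) →
      ∀ g : G, ⁅u, g⁆ ∈ Subgroup.center G := by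
    intro u hu g
    have e : π g * π u = π u * π g := hu (π g)
    have : π ⁅u, g⁆ = 1 := by
      rw [commutatorElement_def, map_mul, map_mul, map_mul, map_inv, map_inv, ← e]; group
    rwa [hπ, QuotientGroup.mk'_apply, QuotientGroup.eq_one_iff] at this
  -- Case `ε ≡ 1`: `Ḡ` abelian, `G` nilpotent
  by_cases hall : ∀ q : G ⧸ Subgroup.center G, ε q = 1
  · have hcomm : ∀ p q : G ⧸ Subgroup.center G, p * q = q * p :=
      fun p q => CoordLift.comm_of_eps_one h (hall p) (hall q)
    haveI : Group.IsNilpotent (G ⧸ Subgroup.center G) := ⟨⟨1, by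
      rw [Subgroup.upperCentralSeries_one, eq_top_iff]
      intro q _; rw [Subgroup.mem_center_iff]; intro p; exact hcomm p q⟩⟩
    haveI : Group.IsNilpotent G := Subgroup.isNilpotent_of_ker_le_center π (by rw [hπ, QuotientGroup.ker_mk'])
    exact TwoGroup.boxRatioSectionLaw_of_isNilpotent hG
  push Not at hall
  obtain ⟨q₀, hq₀⟩ := hall
  have hεq₀ : ε q₀ = -1 := (h.sign q₀).resolve_left hq₀
  -- an `s̄` with `ε = -1` and `κ = 0`, then a `2`-element `s` over a power of it
  set k₀ : G ⧸ Subgroup.center G := d₁ ^ (-κ₁ q₀).val * d₂ ^ (-κ₂ q₀).val with hk₀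
  have hk₀K : DihC3Sq.InK2 d₁ d₂ k₀ := (h.inK2_iff _).2 ⟨_, ZMod.val_lt _, _, ZMod.val_lt _, rfl⟩
  obtain ⟨hk₀1, hk₀2⟩ := CoordLift.kap_inK_pow h (-κ₁ q₀).val (-κ₂ q₀).val
  set q₁ := k₀ * q₀ with hq₁
  have hεq₁ : ε q₁ = -1 := by rw [hq₁, h.eps_mul, h.inK_eps hk₀K, hεq₀, one_mul]
  have hκq₁ : κ₁ q₁ = 0 ∧ κ₂ q₁ = 0 := by
    constructor
    · rw [hq₁, h.kap1_mul, h.inK_eps hk₀K, hk₀1, ZMod.natCast_zmod_val]; ring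
    · rw [hq₁, h.kap2_mul, h.inK_eps hk₀K, hk₀2, ZMod.natCast_zmod_val]; ring
  have hκpow : ∀ n : ℕ, κ₁ (q₁ ^ n) = 0 ∧ κ₂ (q₁ ^ n) = 0 := by
    intro n
    induction n with
    | zero => rw [pow_zero]; exact ⟨h.kap1_one, h.kap2_one⟩
    | succ n ih => rw [pow_succ, h.kap1_mul, h.kap2_mul, ih.1, ih.2, hκq₁.1, hκq₁.2]; simp
  obtain ⟨s', hs'⟩ := hπs q₁
  obtain ⟨j, n₂, hn₂, hsn⟩ := Nat.exists_eq_two_pow_mul_odd (orderOf_pos s').ne'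
  set s := s' ^ n₂ with hsdef
  have hsord : orderOf s = 2 ^ j := orderOf_pow_oddPart hsn
  have hπs_eq : π s = q₁ ^ n₂ := by rw [hsdef, map_pow, hs']
  have hεs : ε (π s) = -1 := by rw [hπs_eq, CoordLift.eps_pow h, hεq₁, hn₂.neg_one_pow]
  have hκs : κ₁ (π s) = 0 ∧ κ₂ (π s) = 0 := by rw [hπs_eq]; exact hκpow n₂
  -- `3`-elements `r₁, r₂` over `K̄`, commuting, with coordinates on the two axes
  have lift3 : ∀ (d : G ⧸ Subgroup.center G), ∃ (r : G) (b m : ℕ), ¬ 3 ∣ m ∧ r ^ 3 ^ b = 1 ∧ π r = d ^ m := by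
    intro d
    obtain ⟨g, hg⟩ := hπs d
    obtain ⟨b, m, hm, hgn⟩ := Nat.exists_eq_pow_mul_and_not_dvd (orderOf_pos g).ne' 3 (by norm_num)
    refine ⟨g ^ m, b, m, hm, ?_, by rw [map_pow, hg]⟩
    rw [← pow_mul, mul_comm, ← hgn]; exact pow_orderOf_eq_one g
  obtain ⟨r₁, b₁, m₁, hm₁, hr₁3, hπr₁⟩ := lift3 d₁
  obtain ⟨r₂', b₂, m₂, hm₂, hr₂'3, hπr₂'⟩ := lift3 d₂
  have h3r₁ : IsPGroup 3 (Subgroup.zpowers r₁) := by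
    obtain ⟨c, -, hc⟩ := (Nat.dvd_prime_pow Nat.prime_three).1 (orderOf_dvd_of_pow_eq_one hr₁3)
    exact IsPGroup.of_card (by rw [Nat.card_zpowers, hc])
  have h3r₂ : IsPGroup 3 (Subgroup.zpowers r₂') := by
    obtain ⟨c, -, hc⟩ := (Nat.dvd_prime_pow Nat.prime_three).1 (orderOf_dvd_of_pow_eq_one hr₂'3)
    exact IsPGroup.of_card (by rw [Nat.card_zpowers, hc])
  obtain ⟨T, hT⟩ := h3r₁.exists_le_sylow
  obtain ⟨T₂, hT₂⟩ := h3r₂.exists_le_sylow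
  obtain ⟨x, hx⟩ := MulAction.exists_smul_eq G T₂ T
  set r₂ := x * r₂' * x⁻¹ with hr₂def
  have hr₂T : r₂ ∈ (T : Subgroup G) := by
    have e : ((x • T₂ : Sylow 3 G) : Subgroup G) = (T : Subgroup G) := congrArg (fun R : Sylow 3 G => (R : Subgroup G)) hx
    rw [Sylow.coe_subgroup_smul] at e
    rw [← e]
    have := Subgroup.smul_mem_pointwise_smul r₂' (MulAut.conj x) (T₂ : Subgroup G) (hT₂ (Subgroup.mem_zpowers _))
    simpa [MulAut.smul_def, MulAut.conj_apply] using this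
  have hr₁T : r₁ ∈ (T : Subgroup G) := hT (Subgroup.mem_zpowers _)
  have hr₁₂ : Commute r₁ r₂ := OddPGroup.sylow_comm_of_boxUseful (by decide : Odd 3) hG T _ _ hr₁T hr₂T
  have hr₂3 : r₂ ^ 3 ^ b₂ = 1 := by rw [hr₂def, conj_pow', hr₂'3]; group
  -- coordinates of the images
  have hπr₁K : DihC3Sq.InK2 d₁ d₂ (π r₁) := by
    rw [hπr₁, h.inK2_iff]
    exact ⟨m₁ % 3, Nat.mod_lt _ (by norm_num), 0, by norm_num, by rw [pow_zero, mul_one, ← h.c1_pow_mod]⟩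
  have hκr₁ : κ₁ (π r₁) = (m₁ : ZMod 3) ∧ κ₂ (π r₁) = 0 := by
    have := CoordLift.kap_inK_pow h m₁ 0
    rw [pow_zero, mul_one] at this
    rw [hπr₁]; exact ⟨this.1, by rw [this.2, Nat.cast_zero]⟩
  have hπr₂'K : DihC3Sq.InK2 d₁ d₂ (π r₂') := by
    rw [hπr₂', h.inK2_iff]
    exact ⟨0, by norm_num, m₂ % 3, Nat.mod_lt _ (by norm_num), by rw [pow_zero, one_mul, ← h.c2_pow_mod]⟩
  have hκr₂' : κ₁ (π r₂') = 0 ∧ κ₂ (π r₂') = (m₂ : ZMod 3) := by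
    have := CoordLift.kap_inK_pow h 0 m₂
    rw [pow_zero, one_mul] at this
    rw [hπr₂']; exact ⟨by rw [this.1, Nat.cast_zero], this.2⟩
  have hπr₂e : π r₂ = π x * π r₂' * (π x)⁻¹ := by rw [hr₂def, map_mul, map_mul, map_inv]
  have hπr₂K : DihC3Sq.InK2 d₁ d₂ (π r₂) := by rw [hπr₂e]; exact h.inK_conj hπr₂'K _
  have hκr₂ : κ₁ (π r₂) = 0 ∧ κ₂ (π r₂) = ε (π x) * (m₂ : ZMod 3) := by
    rw [hπr₂e, CoordLift.kap1_conj_inK h _ hπr₂'K, CoordLift.kap2_conj_inK h _ hπr₂'K, hκr₂'.1, hκr₂'.2, mul_zero]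
    exact ⟨rfl, rfl⟩
  ------------------------------------------------------------------
  -- the elements `a₁, a₂`
  obtain ⟨w₁, hw₁, ha₁3, hsa₁, hπa₁⟩ := mk_inverted hG h hεs hr₁3 hπr₁K
  obtain ⟨w₂, hw₂, ha₂3, hsa₂, hπa₂⟩ := mk_inverted hG h hεs hr₂3 hπr₂K
  set a₁ := r₁ * r₁ * w₁⁻¹ with ha₁
  set a₂ := r₂ * r₂ * w₂⁻¹ with ha₂
  have hw₁c := Subgroup.mem_center_iff.mp hw₁
  have hw₂c := Subgroup.mem_center_iff.mp hw₂
  have ha12 : Commute a₁ a₂ := by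
    have c11 : Commute (r₁ * r₁) (r₂ * r₂) := (hr₁₂.mul_right hr₁₂).mul_left (hr₁₂.mul_right hr₁₂)
    have c1w : Commute (r₁ * r₁) w₂⁻¹ := (show Commute (r₁ * r₁) w₂ from hw₂c _).inv_right
    have cw1 : Commute w₁⁻¹ (r₂ * r₂ * w₂⁻¹) := (show Commute (r₂ * r₂ * w₂⁻¹) w₁ from hw₁c _).inv_right.symm
    exact (c11.mul_right c1w).mul_left cw1
  have ha1odd : Odd (orderOf a₁) := odd_orderOf_of_pow_three (b := 1) (by rw [pow_one]; exact ha₁3)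
  have ha2odd : Odd (orderOf a₂) := odd_orderOf_of_pow_three (b := 1) (by rw [pow_one]; exact ha₂3)
  -- images and coordinates of `a₁, a₂`
  have hπa₁K : DihC3Sq.InK2 d₁ d₂ (π a₁) := by rw [hπa₁]; exact h.inK_mul hπr₁K hπr₁K
  have hπa₂K : DihC3Sq.InK2 d₁ d₂ (π a₂) := by rw [hπa₂]; exact h.inK_mul hπr₂K hπr₂K
  have hεa₁ : ε (π a₁) = 1 := h.inK_eps hπa₁K
  have hεa₂ : ε (π a₂) = 1 := h.inK_eps hπa₂K
  have hκa₁ : κ₁ (π a₁) = (m₁ : ZMod 3) + (m₁ : ZMod 3) ∧ κ₂ (π a₁) = 0 := by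
    rw [hπa₁, h.kap1_mul, h.kap2_mul, h.inK_eps hπr₁K, hκr₁.1, hκr₁.2, one_mul, one_mul, add_zero]
    exact ⟨rfl, rfl⟩
  have hκa₂ : κ₁ (π a₂) = 0 ∧ κ₂ (π a₂) = ε (π x) * (m₂ : ZMod 3) + ε (π x) * (m₂ : ZMod 3) := by
    rw [hπa₂, h.kap1_mul, h.kap2_mul, h.inK_eps hπr₂K, hκr₂.1, hκr₂.2, one_mul, one_mul, add_zero]
    exact ⟨rfl, rfl⟩
  obtain ⟨f₁, hf₁⟩ : ∃ f : ZMod 3, f = (m₁ : ZMod 3) + (m₁ : ZMod 3) := ⟨_, rfl⟩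
  obtain ⟨f₂, hf₂⟩ : ∃ f : ZMod 3, f = ε (π x) * (m₂ : ZMod 3) + ε (π x) * (m₂ : ZMod 3) := ⟨_, rfl⟩
  rw [← hf₁] at hκa₁
  rw [← hf₂] at hκa₂
  have two_ne : ∀ t : ZMod 3, t ≠ 0 → t + t ≠ 0 := by decide
  have hm₁z : (m₁ : ZMod 3) ≠ 0 := by rw [Ne, ZMod.natCast_eq_zero_iff]; exact hm₁
  have hm₂z : ε (π x) * (m₂ : ZMod 3) ≠ 0 := by
    have hm : (m₂ : ZMod 3) ≠ 0 := by rw [Ne, ZMod.natCast_eq_zero_iff]; exact hm₂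
    rcases h.sign (π x) with e | e <;> rw [e] <;> simpa using hm
  have hf₁0 : f₁ ≠ 0 := hf₁ ▸ two_ne _ hm₁z
  have hf₂0 : f₂ ≠ 0 := hf₂ ▸ two_ne _ hm₂z
  have ha₁1 : a₁ ≠ 1 := by
    intro e; apply hf₁0; rw [← hκa₁.1, e, map_one, h.kap1_one]
  ------------------------------------------------------------------
  -- a Sylow `2`-subgroup through `s` lies in `Z₂ ∪ Z₂ s`, hence is abelian
  have hPs : IsPGroup 2 (Subgroup.zpowers s) := IsPGroup.of_card (by rw [Nat.card_zpowers, hsord])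
  obtain ⟨P, hP⟩ := hPs.exists_le_sylow
  have hsP : s ∈ (P : Subgroup G) := hP (Subgroup.mem_zpowers _)
  have hPord : ∀ p ∈ (P : Subgroup G), ∃ i : ℕ, orderOf p = 2 ^ i := by
    intro p hp
    obtain ⟨i, hi⟩ := IsPGroup.iff_orderOf.mp P.isPGroup' ⟨p, hp⟩
    exact ⟨i, by rw [← hi, Subgroup.orderOf_mk]⟩
  -- `2`-power-order elements with `ε = 1` are second-central
  have sc_of_eps_one : ∀ p ∈ (P : Subgroup G), ε (π p) = 1 → ∀ g : G, ⁅p, g⁆ ∈ Subgroup.center G := by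
    intro p hp he
    apply sc_of_central
    apply CoordLift.central_of_eps_one_of_coprime h he
    obtain ⟨i, hi⟩ := hPord p hp
    obtain ⟨i', -, hi'⟩ := (Nat.dvd_prime_pow Nat.prime_two).1 (hi ▸ orderOf_map_dvd π p)
    rw [hi']; exact Nat.Coprime.pow_left i' (by norm_num)
  have hdich : ∀ p ∈ (P : Subgroup G),
      (∀ g : G, ⁅p, g⁆ ∈ Subgroup.center G) ∨ (∀ g : G, ⁅p * s⁻¹, g⁆ ∈ Subgroup.center G) := by
    intro p hp
    rcases h.sign (π p) with e | e
    · exact Or.inl (sc_of_eps_one p hp e)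
    · right
      apply sc_of_eps_one (p * s⁻¹) (Subgroup.mul_mem _ hp (Subgroup.inv_mem _ hsP))
      rw [map_mul, map_inv, h.eps_mul, ← h.eps_inv₂, e, hεs]; decide
  have hPcomm : ∀ p ∈ (P : Subgroup G), ∀ q ∈ (P : Subgroup G), p * q = q * p :=
    sylow_comm_of_dichotomy hG (b := 1) (by rw [pow_one]; exact ha₁3) ha₁1 hsa₁ P hdich
  ------------------------------------------------------------------
  -- the split structure `G = ⟨a₁, a₂⟩ · C`, `C = P ⊔ Z(G)`
  set C : Subgroup G := (P : Subgroup G) ⊔ Subgroup.center G with hC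
  -- elements with `κ(π γ) = 0` lie in `C`
  have memC_of_kap : ∀ γ : G, κ₁ (π γ) = 0 → κ₂ (π γ) = 0 → γ ∈ C := by
    intro γ h1 h2
    rcases h.sign (π γ) with e | e
    · exact mem_sylow_sup_center hG P (sc_of_central γ (CoordLift.central_of_kap_zero h e h1 h2))
    · have h1' : κ₁ (π (γ * s⁻¹)) = 0 := by
        rw [map_mul, map_inv, h.kap1_mul, h.kap1_inv, h1, hκs.1]; ring
      have h2' : κ₂ (π (γ * s⁻¹)) = 0 := by
        rw [map_mul, map_inv, h.kap2_mul, h.kap2_inv, h2, hκs.2]; ring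
      have e' : ε (π (γ * s⁻¹)) = 1 := by rw [map_mul, map_inv, h.eps_mul, ← h.eps_inv₂, e, hεs]; decide
      have hmem := mem_sylow_sup_center hG P (sc_of_central _ (CoordLift.central_of_kap_zero h e' h1' h2'))
      have : γ = (γ * s⁻¹) * s := by group
      rw [this]
      exact Subgroup.mul_mem _ hmem (Subgroup.mem_sup_left hsP)
  have h1 : a₁ * a₁ * a₁ = 1 := by have t := ha₁3; rw [pow_succ, pow_two] at t; exact t
  have h2 : a₂ * a₂ * a₂ = 1 := by have t := ha₂3; rw [pow_succ, pow_two] at t; exact t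
  have hCcomm : ∀ γ ∈ C, ∀ δ ∈ C, γ * δ = δ * γ := by
    intro γ hγ δ hδ
    obtain ⟨p, hp, z, hz, rfl⟩ := (mem_sup_center_iff _ _).1 hγ
    obtain ⟨p', hp', z', hz', rfl⟩ := (mem_sup_center_iff _ _).1 hδ
    have hzc := Subgroup.mem_center_iff.mp hz
    have hz'c := Subgroup.mem_center_iff.mp hz'
    have c1 : Commute p (p' * z') := Commute.mul_right (hPcomm p hp p' hp') (hz'c p)
    have c2 : Commute z (p' * z') := Commute.mul_right (hzc p').symm (hzc z').symm
    exact (c1.mul_left c2).eq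
  have hKC : ∀ a b : ℕ, a₁ ^ a * a₂ ^ b ∈ C → (a : ZMod 3) = 0 ∧ (b : ZMod 3) = 0 := by
    intro a b hmem
    obtain ⟨p, hp, z, hz, e⟩ := (mem_sup_center_iff _ _).1 hmem
    -- the image of `a₁^a a₂^b` is a `2`-element of order dividing `3`: trivial
    have hπz : π z = 1 := by rw [hπ, QuotientGroup.mk'_apply, QuotientGroup.eq_one_iff]; exact hz
    have himg : π (a₁ ^ a * a₂ ^ b) = π p := by
      rw [← e, map_mul, hπz, mul_one]
    have h3 : (π p) ^ 3 = 1 := by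
      rw [← himg, ← map_pow, ((ha12.pow_pow a b)).mul_pow, ← pow_mul, ← pow_mul, mul_comm a, mul_comm b, pow_mul,
        pow_mul, ha₁3, ha₂3, one_pow, one_pow, one_mul, map_one]
    obtain ⟨i, hi⟩ := hPord p hp
    have h2i : (π p) ^ 2 ^ i = 1 := by rw [← hi, ← map_pow, pow_orderOf_eq_one, map_one]
    have hp1 : π p = 1 := by
      rw [← orderOf_eq_one_iff]
      exact Nat.eq_one_of_dvd_coprimes (Nat.Coprime.pow_left i (by norm_num) : Nat.Coprime (2 ^ i) 3)
        (orderOf_dvd_of_pow_eq_one h2i) (orderOf_dvd_of_pow_eq_one h3)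
    rw [hp1] at himg
    have hk1 := congrArg κ₁ himg
    have hk2 := congrArg κ₂ himg
    rw [map_mul, map_pow, map_pow, h.kap1_mul, CoordLift.eps_pow h, hεa₁, one_pow, one_mul,
      CoordLift.kap1_pow_of_eps_one h hεa₁, CoordLift.kap1_pow_of_eps_one h hεa₂, hκa₁.1, hκa₂.1, h.kap1_one] at hk1
    rw [map_mul, map_pow, map_pow, h.kap2_mul, CoordLift.eps_pow h, hεa₁, one_pow, one_mul,
      CoordLift.kap2_pow_of_eps_one h hεa₁, CoordLift.kap2_pow_of_eps_one h hεa₂, hκa₁.2, hκa₂.2, h.kap2_one] at hk2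
    have key : ∀ t f : ZMod 3, f ≠ 0 → t * f = 0 → t = 0 := by decide
    constructor
    · exact key _ _ hf₁0 (by simpa using hk1)
    · exact key _ _ hf₂0 (by simpa using hk2)
  have hgen : ∀ g : G, ∃ (a b : ℕ) (γ : G), γ ∈ C ∧ g = a₁ ^ a * a₂ ^ b * γ := by
    intro g
    set a := (κ₁ (π g) * f₁).val with hadef
    set b := (κ₂ (π g) * f₂).val with hbdef
    refine ⟨a, b, (a₁ ^ a * a₂ ^ b)⁻¹ * g, ?_, by group⟩
    have sq : ∀ f : ZMod 3, f ≠ 0 → f * f = 1 := by decide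
    have hεk : ε (π (a₁ ^ a * a₂ ^ b)) = 1 := by
      rw [map_mul, map_pow, map_pow, h.eps_mul, CoordLift.eps_pow h, CoordLift.eps_pow h, hεa₁, hεa₂, one_pow, one_pow,
        mul_one]
    have hk1 : κ₁ (π (a₁ ^ a * a₂ ^ b)) = κ₁ (π g) := by
      rw [map_mul, map_pow, map_pow, h.kap1_mul, CoordLift.eps_pow h, hεa₁, one_pow, one_mul,
        CoordLift.kap1_pow_of_eps_one h hεa₁, CoordLift.kap1_pow_of_eps_one h hεa₂, hκa₁.1, hκa₂.1, mul_zero, add_zero,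
        hadef, ZMod.natCast_zmod_val, mul_assoc, sq f₁ hf₁0, mul_one]
    have hk2 : κ₂ (π (a₁ ^ a * a₂ ^ b)) = κ₂ (π g) := by
      rw [map_mul, map_pow, map_pow, h.kap2_mul, CoordLift.eps_pow h, hεa₁, one_pow, one_mul,
        CoordLift.kap2_pow_of_eps_one h hεa₁, CoordLift.kap2_pow_of_eps_one h hεa₂, hκa₁.2, hκa₂.2, mul_zero, zero_add,
        hbdef, ZMod.natCast_zmod_val, mul_assoc, sq f₂ hf₂0, mul_one]
    apply memC_of_kap
    · rw [map_mul, map_inv, h.kap1_mul, h.kap1_inv, ← h.eps_inv₂, hεk, hk1]; ring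
    · rw [map_mul, map_inv, h.kap2_mul, h.kap2_inv, ← h.eps_inv₂, hεk, hk2]; ring
  have hact : ∀ γ ∈ C, (γ * a₁ * γ⁻¹ = a₁ ∧ γ * a₂ * γ⁻¹ = a₂) ∨ (γ * a₁ * γ⁻¹ = a₁⁻¹ ∧ γ * a₂ * γ⁻¹ = a₂⁻¹) := by
    intro γ hγ
    obtain ⟨p, hp, z, hz, rfl⟩ := (mem_sup_center_iff _ _).1 hγ
    have hzc := Subgroup.mem_center_iff.mp hz
    have hconj : ∀ a : G, p * z * a * (p * z)⁻¹ = p * a * p⁻¹ := fun a => by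
      rw [mul_inv_rev, mul_assoc p z, ← hzc a]; group
    rw [hconj, hconj]
    rcases hdich p hp with hsc | hsc
    · left
      exact ⟨by rw [SecondCentre.comm_of_odd hG hsc ha1odd, mul_inv_cancel_right],
        by rw [SecondCentre.comm_of_odd hG hsc ha2odd, mul_inv_cancel_right]⟩
    · right
      exact ⟨conj_eq_inv_of_secondCentral_mul hG ha1odd hsa₁ hsc, conj_eq_inv_of_secondCentral_mul hG ha2odd hsa₂ hsc⟩
  obtain ⟨κ₁', κ₂', ε', hC2⟩ := DihC3Sq.exists_coord2_of_split h1 h2 ha12.eq hCcomm hKC hgen hact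
  exact Or.inr (Or.inr (Or.inr ⟨a₁, a₂, κ₁', κ₂', ε', hC2⟩))

end CentreLift

end Summit.MatrixMultiplication.OmegaCensus
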